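import Summits.PneNP.PneNP.Theorems.KarlinRubinMonotoneSufficesSandwich
import Literature.Computability.Complexity.RossmanMonotoneCliqueThm2Proofs

/-!
# Route KarlinRubin, crux `MonotoneBlind` (stmt-PneNP-18027): monotonicity in the clique exponent

`MonotoneBlind` (X₂ of route KarlinRubin) says: for every `δ ∈ (0,1/2)` and every `c`, no family of
circuits over `{∧₂, ∨₂, 0, 1}` of size `≤ n^c` (eventually) has
`Pr_{G(n,1/2)}[C n = 1] + Pr_{G(n,1/2) ∪ K_A, |A| = ⌈n^{1/2-δ}⌉}[C n = 0] → 0`.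

This file proves, sorry-free (helpers `--supports stmt-PneNP-18027`), the structural facts about the
clique-size parameter that every line of attack on the crux uses (strategist census D0/D3,
`Cruxes/MonotoneBlind/STRATEGY-CENSUS.md`; the statement `DeltaMonotone` typed there is discharged here):

* `plant_mono_set`, `plantedCliqueDist_false_le_of_le` — **planting more is rejected less**: for a
  MONOTONE test `f` and `k₁ ≤ k₂`, `Pr_{G(n,1/2,k₂)}[f = 0] ≤ Pr_{G(n,1/2,k₁)}[f = 0]` (a uniformly random
  `k₂`-set contains a uniformly random `k₁`-set and planting is monotone in the set; the averaging step is
  the double count `sum_powersetCard_le_of_antitone`);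
* `karlinRubin_detects_of_le` — hence a monotone family strongly detecting the planted `⌈n^{1/2-δ₁}⌉`-clique
  strongly detects the planted `⌈n^{1/2-δ₂}⌉`-clique for every `δ₂ ≤ δ₁` (same family, same type-I error);
* `karlinRubin_monotoneBlindAt_of_le` — blindness at `δ₂` gives blindness at every `δ₁ ≥ δ₂`;
* `karlinRubin_monotoneBlind_iff_small`, `karlinRubin_monotoneBlind_iff_seq` — the filed `∀ δ` crux is
  EQUIVALENT to blindness at arbitrarily small `δ`, e.g. along `δ_m = 1/(m+3)`: its whole content sits at
  the `δ → 0⁺` end (planted cliques just below `√n`, room `n^{Θ(δ log n)}` versus `n^c`), whereas the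
  route's deciding theorem consumes one exponent only;
* `karlinRubin_monotoneBasis01_subset_B2`, `karlinRubin_monotoneBlind_of_noPolyB2Detector`,
  `karlinRubin_monotoneBlind_iff_noPolyB2Detector_of_monotoneSuffices` — the trivial direction of the
  sandwich: polynomial nonuniform planted-clique hardness for `B₂`-circuits implies `MonotoneBlind`
  (`{∧₂, ∨₂, 0, 1} ⊆ B₂`), and under the sibling crux `MonotoneSuffices` the two are equivalent
  (with `karlinRubin_noPolyDetector_of_monotoneSuffices_of_monotoneBlind`).
-/

set_option linter.dupNamespace false -- `Summit.PneNP.PneNP.…`: summit = sub-problem (D-0017)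

namespace Summit.PneNP.PneNP.Theorems

open Filter Topology Finset
open scoped ENNReal
open Literature.Computability.Complexity
open Literature.Probability.RandomGraphs.PlantedClique
open Summit.PneNP.PneNP.Theses.KarlinRubin

/-! ### Averaging an antitone set function over uniform subsets of two sizes -/

/-- **Double count.** For an antitone `g` on subsets of `Fin n` (larger set, smaller value) and
`d₁ ≤ d₂ ≤ n`, the average of `g` over the `d₂`-subsets is at most its average over the `d₁`-subsets:
`C(d₂,d₁) · g(T) ≤ Σ_{S ⊆ T, |S| = d₁} g(S)` for each `T`, every `d₁`-set lies in `C(n-d₁, d₂-d₁)` of the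
`T`, and `C(n,d₂) C(d₂,d₁) = C(n,d₁) C(n-d₁,d₂-d₁)`. Stated with the averages as `(C(n,d))⁻¹ · Σ`.
[folklore] -/
theorem sum_powersetCard_le_of_antitone {n : ℕ} (g : Finset (Fin n) → ℝ≥0∞)
    (hg : ∀ S T : Finset (Fin n), S ⊆ T → g T ≤ g S) {d₁ d₂ : ℕ} (h12 : d₁ ≤ d₂) (h2 : d₂ ≤ n) :
    ((n.choose d₂ : ℕ) : ℝ≥0∞)⁻¹ * ∑ T ∈ powersetCard d₂ (univ : Finset (Fin n)), g T ≤
      ((n.choose d₁ : ℕ) : ℝ≥0∞)⁻¹ * ∑ S ∈ powersetCard d₁ (univ : Finset (Fin n)), g S := by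
  classical
  set A := ∑ T ∈ powersetCard d₂ (univ : Finset (Fin n)), g T with hA
  set B := ∑ S ∈ powersetCard d₁ (univ : Finset (Fin n)), g S with hB
  -- (1) inside one `d₂`-set
  have hstep1 : ∀ T ∈ powersetCard d₂ (univ : Finset (Fin n)),
      ((d₂.choose d₁ : ℕ) : ℝ≥0∞) * g T ≤ ∑ S ∈ powersetCard d₁ T, g S := by
    intro T hT
    have hTc : #T = d₂ := (mem_powersetCard.1 hT).2
    have h := Finset.card_nsmul_le_sum (powersetCard d₁ T) g (g T)
      fun S hS => hg S T (mem_powersetCard.1 hS).1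
    rwa [card_powersetCard, hTc, nsmul_eq_mul] at h
  -- (2) exchanging the two sums
  have hfilter : ∀ T : Finset (Fin n),
      powersetCard d₁ T = (powersetCard d₁ (univ : Finset (Fin n))).filter (· ⊆ T) := by
    intro T
    ext S
    simp only [mem_powersetCard, mem_filter, subset_univ, true_and]
    tauto
  have hcount : ∀ S ∈ powersetCard d₁ (univ : Finset (Fin n)),
      #((powersetCard d₂ (univ : Finset (Fin n))).filter (S ⊆ ·)) = (n - d₁).choose (d₂ - d₁) := by
    intro S hS
    have hSc : #S = d₁ := (mem_powersetCard.1 hS).2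
    rw [Finset.card_filter_powersetCard_subset S univ d₂ (subset_univ S) (hSc ▸ h12), card_univ,
      Fintype.card_fin, hSc]
  have hstep2 : ∑ T ∈ powersetCard d₂ (univ : Finset (Fin n)), ∑ S ∈ powersetCard d₁ T, g S =
      (((n - d₁).choose (d₂ - d₁) : ℕ) : ℝ≥0∞) * B := by
    calc ∑ T ∈ powersetCard d₂ (univ : Finset (Fin n)), ∑ S ∈ powersetCard d₁ T, g S
        = ∑ T ∈ powersetCard d₂ (univ : Finset (Fin n)),
            ∑ S ∈ powersetCard d₁ (univ : Finset (Fin n)), (if S ⊆ T then g S else 0) := by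
          refine sum_congr rfl fun T _ => ?_
          rw [hfilter T, sum_filter]
      _ = ∑ S ∈ powersetCard d₁ (univ : Finset (Fin n)),
            ∑ T ∈ powersetCard d₂ (univ : Finset (Fin n)), (if S ⊆ T then g S else 0) := sum_comm
      _ = ∑ S ∈ powersetCard d₁ (univ : Finset (Fin n)), (((n - d₁).choose (d₂ - d₁) : ℕ) : ℝ≥0∞) * g S := by
          refine sum_congr rfl fun S hS => ?_
          rw [← sum_filter, sum_const, hcount S hS, nsmul_eq_mul]
      _ = (((n - d₁).choose (d₂ - d₁) : ℕ) : ℝ≥0∞) * B := by rw [hB, mul_sum]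
  -- (3) the cross-multiplied inequality
  have hcross : ((d₂.choose d₁ : ℕ) : ℝ≥0∞) * A ≤ (((n - d₁).choose (d₂ - d₁) : ℕ) : ℝ≥0∞) * B := by
    calc ((d₂.choose d₁ : ℕ) : ℝ≥0∞) * A
        = ∑ T ∈ powersetCard d₂ (univ : Finset (Fin n)), ((d₂.choose d₁ : ℕ) : ℝ≥0∞) * g T := by
          rw [hA, mul_sum]
      _ ≤ ∑ T ∈ powersetCard d₂ (univ : Finset (Fin n)), ∑ S ∈ powersetCard d₁ T, g S := sum_le_sum hstep1
      _ = _ := hstep2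
  -- (4) divide by `C(n,d₂) C(d₂,d₁) = C(n,d₁) C(n-d₁,d₂-d₁)`
  have hchoose : ((n.choose d₂ : ℕ) : ℝ≥0∞) * ((d₂.choose d₁ : ℕ) : ℝ≥0∞) =
      ((n.choose d₁ : ℕ) : ℝ≥0∞) * (((n - d₁).choose (d₂ - d₁) : ℕ) : ℝ≥0∞) := by
    rw [← Nat.cast_mul, ← Nat.cast_mul, Nat.choose_mul h12]
  have hc0 : ((d₂.choose d₁ : ℕ) : ℝ≥0∞) ≠ 0 := by exact_mod_cast (Nat.choose_pos h12).ne'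
  have he0 : (((n - d₁).choose (d₂ - d₁) : ℕ) : ℝ≥0∞) ≠ 0 := by
    exact_mod_cast (Nat.choose_pos (Nat.sub_le_sub_right h2 d₁)).ne'
  have ha0 : ((n.choose d₂ : ℕ) : ℝ≥0∞) ≠ 0 := by exact_mod_cast (Nat.choose_pos h2).ne'
  have hb0 : ((n.choose d₁ : ℕ) : ℝ≥0∞) ≠ 0 := by exact_mod_cast (Nat.choose_pos (h12.trans h2)).ne'
  have htop : ∀ m : ℕ, ((m : ℕ) : ℝ≥0∞) ≠ ⊤ := fun m => ENNReal.natCast_ne_top m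
  calc ((n.choose d₂ : ℕ) : ℝ≥0∞)⁻¹ * A
      = ((n.choose d₂ : ℕ) : ℝ≥0∞)⁻¹ * (((d₂.choose d₁ : ℕ) : ℝ≥0∞)⁻¹ *
          (((d₂.choose d₁ : ℕ) : ℝ≥0∞) * A)) := by
        rw [← mul_assoc ((d₂.choose d₁ : ℕ) : ℝ≥0∞)⁻¹, ENNReal.inv_mul_cancel hc0 (htop _), one_mul]
    _ ≤ ((n.choose d₂ : ℕ) : ℝ≥0∞)⁻¹ * (((d₂.choose d₁ : ℕ) : ℝ≥0∞)⁻¹ *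
          ((((n - d₁).choose (d₂ - d₁) : ℕ) : ℝ≥0∞) * B)) := by
        gcongr
    _ = (((n.choose d₂ : ℕ) : ℝ≥0∞) * ((d₂.choose d₁ : ℕ) : ℝ≥0∞))⁻¹ *
          ((((n - d₁).choose (d₂ - d₁) : ℕ) : ℝ≥0∞) * B) := by
        rw [ENNReal.mul_inv (Or.inl ha0) (Or.inl (htop _)), mul_assoc]
    _ = (((n.choose d₁ : ℕ) : ℝ≥0∞) * (((n - d₁).choose (d₂ - d₁) : ℕ) : ℝ≥0∞))⁻¹ *
          ((((n - d₁).choose (d₂ - d₁) : ℕ) : ℝ≥0∞) * B) := by rw [hchoose]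
    _ = ((n.choose d₁ : ℕ) : ℝ≥0∞)⁻¹ * ((((n - d₁).choose (d₂ - d₁) : ℕ) : ℝ≥0∞)⁻¹ *
          (((n - d₁).choose (d₂ - d₁) : ℕ) : ℝ≥0∞)) * B := by
        rw [ENNReal.mul_inv (Or.inl hb0) (Or.inl (htop _))]
        ring
    _ = ((n.choose d₁ : ℕ) : ℝ≥0∞)⁻¹ * B := by
        rw [ENNReal.inv_mul_cancel he0 (htop _), mul_one]

/-! ### Planting more is rejected less -/

/-- Planting a clique on a larger vertex set switches on more edges. [folklore] -/
theorem plant_mono_set {n : ℕ} {S T : Finset (Fin n)} (hST : S ⊆ T) (x : EdgeVec n) :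
    plant S x ≤ plant T x := by
  classical
  intro e
  rw [Bool.le_iff_imp]
  simp only [plant, Bool.or_eq_true, decide_eq_true_eq]
  rintro (h | h)
  · exact Or.inl h
  · exact Or.inr fun v hv => hST (h v hv)

/-- **The planted law of a monotone test, fibred over the planted set.**
`Pr_{G(n,1/2,k)}[f = 0] = C(n, d)⁻¹ · Σ_{|S| = d} Pr_{G(n,1/2)}[f(plant S ·) = 0]`, `d = min k n`
(written over `kSubsets n k`, the `min k n`-subsets). [folklore] -/
theorem plantedCliqueDist_false_eq_sum {n : ℕ} (k : ℕ) (f : EdgeVec n → Bool) :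
    (plantedCliqueDist n k).toOuterMeasure {x | f x = false} =
      ((#(kSubsets n k) : ℕ) : ℝ≥0∞)⁻¹ *
        ∑ S ∈ kSubsets n k, (erdosRenyiHalf n).toOuterMeasure {x | f (plant S x) = false} := by
  classical
  rw [plantedCliqueDist, PMF.toOuterMeasure_map_apply, plantedCliqueJoint,
    PMF.toOuterMeasure_bind_apply, tsum_eq_sum (s := kSubsets n k)]
  · rw [mul_sum]
    refine sum_congr rfl fun S hS => ?_
    rw [PMF.uniformOfFinset_apply, if_pos hS, PMF.toOuterMeasure_map_apply]
    rfl
  · intro S hS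
    rw [PMF.uniformOfFinset_apply, if_neg hS, zero_mul]

/-- `#(kSubsets n k) = C(n, min k n)`. [folklore] -/
theorem card_kSubsets_eq_choose (n k : ℕ) : #(kSubsets n k) = n.choose (min k n) := by
  rw [kSubsets, card_powersetCard, card_univ, Fintype.card_fin]

/-- **Planting more is rejected less.** For a MONOTONE test `f` on edge vectors and `k₁ ≤ k₂`, the
planted `k₂`-clique distribution puts no more mass on `{f = 0}` than the planted `k₁`-clique
distribution: couple the uniform `min k₂ n`-set `T` with a uniform `min k₁ n`-subset `S ⊆ T`; then
`plant S x ≤ plant T x`, so `f (plant T x) = 0` forces `f (plant S x) = 0`. [folklore] -/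
theorem plantedCliqueDist_false_le_of_le {n k₁ k₂ : ℕ} (hk : k₁ ≤ k₂) (f : EdgeVec n → Bool)
    (hf : Monotone f) :
    (plantedCliqueDist n k₂).toOuterMeasure {x | f x = false} ≤
      (plantedCliqueDist n k₁).toOuterMeasure {x | f x = false} := by
  classical
  rw [plantedCliqueDist_false_eq_sum, plantedCliqueDist_false_eq_sum, card_kSubsets_eq_choose,
    card_kSubsets_eq_choose]
  refine sum_powersetCard_le_of_antitone
    (fun S => (erdosRenyiHalf n).toOuterMeasure {x | f (plant S x) = false}) ?_
    (min_le_min hk le_rfl) (min_le_right k₂ n)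
  intro S T hST
  refine MeasureTheory.OuterMeasure.mono _ fun x hx => ?_
  simp only [Set.mem_setOf_eq] at hx ⊢
  have hle : f (plant S x) ≤ f (plant T x) := hf (plant_mono_set hST x)
  rw [hx] at hle
  cases h : f (plant S x)
  · rfl
  · rw [h] at hle
    exact absurd hle (by decide)

/-! ### Detection is monotone in the clique exponent -/

/-- **`DeltaMonotone` (census D0′), proved.** If a family of circuits over `{∧₂, ∨₂, 0, 1}`
(eventually) has error sum `→ 0` against the planted `⌈n^{1/2-δ₁}⌉`-clique, the SAME family has error
sum `→ 0` against the planted `⌈n^{1/2-δ₂}⌉`-clique for every `δ₂ ≤ δ₁`: the type-I term is unchanged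
and the type-II term does not increase (`plantedCliqueDist_false_le_of_le`, monotone circuits compute
monotone functions). [folklore] -/
theorem karlinRubin_detects_of_le {δ₁ δ₂ : ℝ} (h12 : δ₂ ≤ δ₁)
    {C : (n : ℕ) → Circuit ((⊤ : SimpleGraph (Fin n)).edgeSet)}
    (hB : ∀ᶠ n : ℕ in atTop, (C n).IsOver monotoneBasis01)
    (hT : Tendsto (fun n : ℕ =>
        (erdosRenyiHalf n).toOuterMeasure {x | (C n).eval x = true} +
          (plantedCliqueDist n ⌈(n : ℝ) ^ (1 / 2 - δ₁)⌉₊).toOuterMeasure {x | (C n).eval x = false})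
        atTop (𝓝 0)) :
    Tendsto (fun n : ℕ =>
        (erdosRenyiHalf n).toOuterMeasure {x | (C n).eval x = true} +
          (plantedCliqueDist n ⌈(n : ℝ) ^ (1 / 2 - δ₂)⌉₊).toOuterMeasure {x | (C n).eval x = false})
        atTop (𝓝 0) := by
  refine tendsto_of_tendsto_of_tendsto_of_le_of_le' tendsto_const_nhds hT
    (Eventually.of_forall fun _ => bot_le) ?_
  filter_upwards [hB, eventually_ge_atTop 1] with n hn hn1
  have hmono : Monotone (C n).eval := (C n).monotone_eval_of_isOver_monotoneBasis01 hn
  have hk : ⌈(n : ℝ) ^ (1 / 2 - δ₁)⌉₊ ≤ ⌈(n : ℝ) ^ (1 / 2 - δ₂)⌉₊ :=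
    Nat.ceil_mono (Real.rpow_le_rpow_of_exponent_le (by exact_mod_cast hn1) (by linarith))
  exact add_le_add le_rfl (plantedCliqueDist_false_le_of_le hk _ hmono)

/-- **Blindness propagates to smaller cliques.** If at clique exponent `1/2 - δ₂` no `{∧₂, ∨₂, 0, 1}`
family of size `≤ n^c` strongly detects, then none does at any exponent `1/2 - δ₁ ≤ 1/2 - δ₂`
(`MonotoneBlindAt δ₂ → MonotoneBlindAt δ₁` for `δ₂ ≤ δ₁`, census `monotoneBlindAt_mono` discharged).
[folklore] -/
theorem karlinRubin_monotoneBlindAt_of_le {δ₁ δ₂ : ℝ} (h12 : δ₂ ≤ δ₁)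
    (h : ∀ c : ℕ, ¬ ∃ C : (n : ℕ) → Circuit ((⊤ : SimpleGraph (Fin n)).edgeSet),
      (∀ᶠ n : ℕ in atTop, (C n).IsOver monotoneBasis01 ∧ (C n).size ≤ n ^ c) ∧
        Tendsto (fun n : ℕ =>
          (erdosRenyiHalf n).toOuterMeasure {x | (C n).eval x = true} +
            (plantedCliqueDist n ⌈(n : ℝ) ^ (1 / 2 - δ₂)⌉₊).toOuterMeasure {x | (C n).eval x = false})
          atTop (𝓝 0)) :
    ∀ c : ℕ, ¬ ∃ C : (n : ℕ) → Circuit ((⊤ : SimpleGraph (Fin n)).edgeSet),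
      (∀ᶠ n : ℕ in atTop, (C n).IsOver monotoneBasis01 ∧ (C n).size ≤ n ^ c) ∧
        Tendsto (fun n : ℕ =>
          (erdosRenyiHalf n).toOuterMeasure {x | (C n).eval x = true} +
            (plantedCliqueDist n ⌈(n : ℝ) ^ (1 / 2 - δ₁)⌉₊).toOuterMeasure {x | (C n).eval x = false})
          atTop (𝓝 0) :=
  fun c ⟨C, hC, hT⟩ => h c ⟨C, hC, karlinRubin_detects_of_le h12 (hC.mono fun _ h => h.1) hT⟩

/-- **The crux lives at `δ → 0⁺`.** `MonotoneBlind` holds iff blindness holds at arbitrarily small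
exponents `δ`: for every `ε > 0` some `δ ∈ (0, ε]` (with `δ < 1/2`) is blind. The forward direction is
instantiation at `min ε (1/4)`; the converse is `karlinRubin_monotoneBlindAt_of_le`. So the filed
`∀ δ` crux carries exactly the content of its instances just below `√n` (census D0/D3). [folklore] -/
theorem karlinRubin_monotoneBlind_iff_small :
    MonotoneBlind ↔ ∀ ε : ℝ, 0 < ε → ∃ δ : ℝ, 0 < δ ∧ δ ≤ ε ∧ δ < 1 / 2 ∧
      ∀ c : ℕ, ¬ ∃ C : (n : ℕ) → Circuit ((⊤ : SimpleGraph (Fin n)).edgeSet),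
        (∀ᶠ n : ℕ in atTop, (C n).IsOver monotoneBasis01 ∧ (C n).size ≤ n ^ c) ∧
          Tendsto (fun n : ℕ =>
            (erdosRenyiHalf n).toOuterMeasure {x | (C n).eval x = true} +
              (plantedCliqueDist n ⌈(n : ℝ) ^ (1 / 2 - δ)⌉₊).toOuterMeasure {x | (C n).eval x = false})
            atTop (𝓝 0) := by
  constructor
  · intro h ε hε
    have h4 : min ε (1 / 4) < 1 / 2 := (min_le_right _ _).trans_lt (by norm_num)
    exact ⟨min ε (1 / 4), lt_min hε (by norm_num), min_le_left _ _, h4,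
      h _ (lt_min hε (by norm_num)) h4⟩
  · intro h δ hδ _
    obtain ⟨δ', -, hle, -, hblind⟩ := h δ hδ
    exact karlinRubin_monotoneBlindAt_of_le hle hblind

/-- **Sequential form.** `MonotoneBlind` holds iff it holds along the single sequence of exponents
`δ_m = 1/(m+3)` (`m : ℕ`; all in `(0, 1/3]`), i.e. for planted cliques of size `⌈n^{1/2 - 1/(m+3)}⌉`
(census `monotoneBlind_of_seq` discharged). [folklore] -/
theorem karlinRubin_monotoneBlind_iff_seq :
    MonotoneBlind ↔ ∀ m : ℕ, ∀ c : ℕ, ¬ ∃ C : (n : ℕ) → Circuit ((⊤ : SimpleGraph (Fin n)).edgeSet),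
        (∀ᶠ n : ℕ in atTop, (C n).IsOver monotoneBasis01 ∧ (C n).size ≤ n ^ c) ∧
          Tendsto (fun n : ℕ =>
            (erdosRenyiHalf n).toOuterMeasure {x | (C n).eval x = true} +
              (plantedCliqueDist n ⌈(n : ℝ) ^ (1 / 2 - 1 / ((m : ℝ) + 3))⌉₊).toOuterMeasure
                {x | (C n).eval x = false})
            atTop (𝓝 0) := by
  constructor
  · intro h m
    have hpos : (0 : ℝ) < 1 / ((m : ℝ) + 3) := by positivity
    have hlt : 1 / ((m : ℝ) + 3) < 1 / 2 := by
      rw [div_lt_div_iff_of_pos_left one_pos (by positivity) two_pos]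
      have : (0 : ℝ) ≤ m := Nat.cast_nonneg m
      linarith
    exact h _ hpos hlt
  · intro h δ hδ _
    obtain ⟨m, hm⟩ := exists_nat_one_div_lt hδ
    have hle : 1 / ((m : ℝ) + 3) ≤ δ := by
      refine le_trans ?_ hm.le
      exact one_div_le_one_div_of_le (by positivity) (by linarith)
    exact karlinRubin_monotoneBlindAt_of_le hle (h m)

/-! ### The trivial direction of the sandwich -/

/-- `{∧₂, ∨₂, 0, 1} ⊆ B₂` (the constants have fan-in `0`). [folklore] -/
theorem karlinRubin_monotoneBasis01_subset_B2 : monotoneBasis01 ⊆ B2 := by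
  intro g hg
  simp only [monotoneBasis01, Set.mem_insert_iff] at hg
  rcases hg with rfl | rfl | hg
  · show (GateFn.const true).1 ≤ 2
    exact Nat.zero_le 2
  · show (GateFn.const false).1 ≤ 2
    exact Nat.zero_le 2
  · exact deMorganBasis_subset_B2 (monotoneBasis_subset_deMorgan hg)

/-- **Polynomial nonuniform planted-clique hardness implies `MonotoneBlind`.** If for every
`δ ∈ (0,1/2)` no `B₂`-circuit family of size `≤ n^c` strongly detects the planted `⌈n^{1/2-δ}⌉`-clique
(the nonuniform, polynomial form of the planted clique conjecture, Jerrum 1992 §5 / Barak et al. 2019 §1),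
then in particular no `{∧₂, ∨₂, 0, 1}` family does. With
`karlinRubin_noPolyDetector_of_monotoneSuffices_of_monotoneBlind` this closes the sandwich
`PolyHard(B₂) ⟹ MonotoneBlind ⟹ (MonotoneSuffices ⟹ PolyHard(B₂))`. [folklore] -/
theorem karlinRubin_monotoneBlind_of_noPolyB2Detector
    (h : ∀ δ : ℝ, 0 < δ → δ < 1 / 2 → ∀ c : ℕ, ¬ ∃ C : (n : ℕ) → Circuit ((⊤ : SimpleGraph (Fin n)).edgeSet),
      (∀ᶠ n : ℕ in atTop, (C n).IsOver B2 ∧ (C n).size ≤ n ^ c) ∧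
        Tendsto (fun n : ℕ =>
          (erdosRenyiHalf n).toOuterMeasure {x | (C n).eval x = true} +
            (plantedCliqueDist n ⌈(n : ℝ) ^ (1 / 2 - δ)⌉₊).toOuterMeasure {x | (C n).eval x = false})
          atTop (𝓝 0)) :
    MonotoneBlind := by
  intro δ hδ hδ' c hC
  obtain ⟨C, hC, hT⟩ := hC
  exact h δ hδ hδ' c
    ⟨C, hC.mono fun n hn => ⟨hn.1.mono karlinRubin_monotoneBasis01_subset_B2, hn.2⟩, hT⟩

/-- **Under `MonotoneSuffices`, the crux IS polynomial nonuniform planted-clique hardness.** Given the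
sibling crux X₁, `MonotoneBlind` holds iff no polynomial-size `B₂`-family strongly detects the planted
`⌈n^{1/2-δ}⌉`-clique at any `δ ∈ (0,1/2)`. [folklore] -/
theorem karlinRubin_monotoneBlind_iff_noPolyB2Detector_of_monotoneSuffices (hSim : MonotoneSuffices) :
    MonotoneBlind ↔
      ∀ δ : ℝ, 0 < δ → δ < 1 / 2 → ∀ c : ℕ, ¬ ∃ C : (n : ℕ) → Circuit ((⊤ : SimpleGraph (Fin n)).edgeSet),
        (∀ᶠ n : ℕ in atTop, (C n).IsOver B2 ∧ (C n).size ≤ n ^ c) ∧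
          Tendsto (fun n : ℕ =>
            (erdosRenyiHalf n).toOuterMeasure {x | (C n).eval x = true} +
              (plantedCliqueDist n ⌈(n : ℝ) ^ (1 / 2 - δ)⌉₊).toOuterMeasure {x | (C n).eval x = false})
            atTop (𝓝 0) :=
  ⟨karlinRubin_noPolyDetector_of_monotoneSuffices_of_monotoneBlind hSim,
    karlinRubin_monotoneBlind_of_noPolyB2Detector⟩

end Summit.PneNP.PneNP.Theorems
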